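import Summits.QuantumFields.YangMills.Theorems.BalabanUVNodesN11BgRowGaugeRAtCRLetteredMember
import Summits.QuantumFields.YangMills.Theorems.BalabanUVNodesN11Sect3SupplyChainBorelBThm1PrintedOfBgFacts
import Summits.QuantumFields.YangMills.Theorems.BalabanUVNodesN11SupplyChainAtCRLetteredNumerics

/-!
# DAG node N11 × K1 — THE CAPSTONE AT THE cR-LETTERED MEMBER: N11's PRINTED OUTPUT `B16.Thm1Printed` at the Gaussian certificate's K1-keyed datum over the member
# `θ₁₃(n_c, ε₂₉)` (θ₁₅ᶜᶜᴹᵂ's numerics with `s2.cR := c`, `2 ≤ c ≤ 8`) with the bg-facts binder DISCHARGED by the guard-free GaugeR road and `2 ≤ cR` TRUE — what remains is the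
# key (or dag-n11-w3's door), (8), (9), the β-box, K0's solvability and [III] §3's supplier

HEADER — WORK-UNIT METADATA.  Cell `pub-ymgap`, YM-PLAN Track A (HUMAN RULING D-0062 ∕ D-0149 ∕ D-0154 width seats), seat `pub-ymgap-dag-n11-w5` (g2; WIDTH SEAT 5 on NODE n11
[B14]; dag-n11-w1 g3's OFFER (n1) «CAPSTONE at a cR-lettered member — p626869∕p627901 with `hbgs :=` n11-w5's θ-generic `stage13_bgAtDatumCoP_…_of_hcubeΩ` at n11-w3's `ccmwCR`
numerics», INBOX l.36654; CLAIM-4 l.36707), route `BalabanUVNodes` rev 29, item K1⁹ `StabilityBRunRowsAtRecordR13SepCoPHV` = stmt-QuantumFields-27364 (helper lane,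
`--kind proof --supports 27364 --as helper`, count-neutral).  [III] = [Balaban1988Convergent], [I] = [Balaban1987RG1], [15] = [Balaban1985Variational], [LF-II] = [Balaban1989LargeFieldII].
Over dag-n11-w1 g3's p627901 `…N11Sect3SupplyChainBorelBThm1PrintedOfBgFacts` (★★★★★ `thm1Printed_datumOfRecord₁₃SepCoPH_gaussPinH_of_supplierBorel_of_bgFacts_of_powM`), this seat's
`…N11BgRowGaugeRAtCRLetteredMember` (§3 `bgFacts_ccmwCRH_of_thm1GaugeR_of_hcomp_of_hjm`), dag-n11-w3 g4's p619867 `…N11SupplyChainAtCRLetteredNumerics` (`two_le_cR_of_ccmwCRH`,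
`nesting_of_ccmwCRH`, `numericRows_of_ccmwCRH`, `ccmwCR_pos`) and p620936 `…N11K0DoorAtCRLetteredNumerics` (`hcompBoth_ccmwCR_of_betaBoxSignFree`,
`provisos₁₃SepCoPH_door_ccmwCR_of_gauge9TopStepR_of_betaBoxSignFree_allTorus`), B′'s `variationalThm1GaugeRegSepCoP7MR_of_gauge9TopStepR`.

WHY THIS FILE.  p627901 left N11's printed face at the Gaussian certificate with every binder «satisfiable in kind» but two of them unsatisfied at K1's witness of record: `2 ≤ cR`
(θ₁₅ᶜᶜᴹᵂ has `cR = 1`, dag-n11-d LOCATED-cR) and the bg facts `hbgs` (this seat's p626404 supplies them at θ₁₅ᶜᶜᴹᵂ only).  dag-n11-w3 g4's cR-lettered members make `2 ≤ cR`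
true with every other K1 letter `rfl`-unchanged, and `…BgRowGaugeRAtCRLetteredMember` supplies `hbgs` THERE without the run guard.  Composing the two with p627901 and n11-w3's
member letters closes the CAPSTONE n11-w1 offered: N11's printed output at the member with NO bg binder, NO run guard, NO geometric row and NO numeral side condition left — only
the key, the analytic letters (8)∕(9)∕β-box, K0's per-cube [15]-solvability and [III] §3's supplier (XL, nobody's theorem yet).

WHAT THIS FILE PROVES (0 `sorry`, 0 `def`; two compositions BY NAME; nothing of Bałaban asserted).
§1 ★★★★★ `thm1Printed_gaussPinH_ccmwCRH_of_supplierBorel_of_solvable_of_hjm` (any H-extension, key displayed) · ★★★★★ `thm1Printed_gaussPinH_door_ccmwCR_of_supplierBorel_of_solvable_of_hjm`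
(the history-blind door, key by dag-n11-w3's door theorem).

HONEST FRAMING.  Helper lane of K1⁹; count-neutral; CONDITIONAL on the [15] letters (8) `VariationalThm1RegSepCoP7M`, (9) `Gauge9RegSepTopStepR`, the sign-free windowed β-box
of `betaOfRecord₁₃ F N θ₁₅ᶜᶜᴹᵂ`, the window∕sign letters, the four γ-conditions, `2 ≤ c ≤ 8`, `1 ≤ j`, `hjm : j + 1 ≤ F.m`, K0's per-cube [15]-solvability and [III] §3's supplier with
`SupplierObligations ∧ SupplierBorel` — all DISPLAYED, inhabited nowhere here; NOT a discharge of N11; NOT a re-pin of any witness of record (the member is a re-lettered copy of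
θ₁₅ᶜᶜᴹᵂ; at `c := 1` it IS θ₁₅ᶜᶜᴹᵂ, where `2 ≤ cR` fails).  N11 ∕ N07 NOT discharged; K0⁷ ∕ K1⁹ NOT closed, no registered stub touched; counts unmoved (typed 28∕28 · discharged
5∕27); no summit statement is proved by this seat.  R4 closes only the conditional finite-𝕋⁴ rung `BalabanLadder.UV` of one programme at fixed `ε = L^{−K}` — NOT ℝ⁴, NOT OS, NOT a
mass gap, NOT Clay.  No `sorry`, `axiom`, `def`, `instance`, `notation`.
Sources (SHAPE ∕ bookkeeping only): [III] Thm 1 p.262, Theorem p.245, §3 p.279, (0.2) p.244, (2.4)–(2.8) pp.255–256, (2.10) p.256, (2.28) p.259, (3.16) p.268, (3.24)–(3.25) p.270;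
[LF-II] Thm 1 p.355; [15] (6)–(7) p.278, Thm 1 (8)–(9) p.279, (144)–(152) pp.300–301, Prop. 8 p.304; [I] Thm 1 p.259, (0.20) p.256, (1.12) p.262, (1.20)–(1.22) p.264.
-/

noncomputable section

open MeasureTheory
open scoped BigOperators ENNReal NNReal Matrix.Norms.L2Operator

namespace Summit.QuantumFields.YangMills.Theorems.BalabanUVNodesN11Thm1PrintedAtCRLetteredMemberOfBgFacts

open Literature.MathematicalPhysics.QuantumFieldTheory.Balaban1983to89 T4Continuum T4NestedCovariance Node00 Node00.Tk DagBinding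
open B15DeterminingSets B8Eq17ClassAkV1 B14.Eq218Concrete B10Eq42TorusConstraint FlowStep
open B14.Eq213MaximalDomains (side)
open B14.Eq213DetSet (Bj)
open Literature.MathematicalPhysics.QuantumFieldTheory.BalabanImbrieJaffe1984to88.BIJ85Eq453GaugeField (qsstarGIter0)
open BalabanUVNodesN11GaussianCertificateDefs (gaussPinH provisos₁₃CoPH_gaussPinH)
open BalabanUVNodesN11Sect3SupplyChainDefs
open BalabanUVNodesN11Sect3SupplyChainBorelB
open BalabanUVNodesN11Sect3SupplyChainObligationsDefs
open BalabanUVNodesN11Sect3SupplyChainBorelBThm1PrintedOfSolvable (provisos₁₃SepCoPH_gaussPinH)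
open BalabanUVNodesN11Sect3SupplyChainBorelBThm1PrintedOfBgFacts (thm1Printed_datumOfRecord₁₃SepCoPH_gaussPinH_of_supplierBorel_of_bgFacts_of_powM)
open BalabanUVNodesN11SupplyChainAtCRLetteredNumerics (two_le_cR_of_ccmwCRH nesting_of_ccmwCRH numericRows_of_ccmwCRH ccmwCR_pos)
open BalabanUVNodesN11K0DoorAtCRLetteredNumerics (hcompBoth_ccmwCR_of_betaBoxSignFree provisos₁₃SepCoPH_door_ccmwCR_of_gauge9TopStepR_of_betaBoxSignFree_allTorus)
open BalabanUVNodesN11BgRowGaugeRAtCRLetteredMember (bgFacts_ccmwCRH_of_thm1GaugeR_of_hcomp_of_hjm)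

variable {F : T4Family} {N : ℕ} [NeZero N] {j c₁₅ : ℕ} {γ c ε₀ ε₂₉ B₃ B₃' a₀ a₁ : ℝ} {θ : Stage13HParams F N}

/-- **★★★★★ THE CAPSTONE — N11's PRINTED OUTPUT `B16.Thm1Printed` AT THE K1-KEYED DATUM OF THE GAUSSIAN CERTIFICATE OVER ANY H-EXTENSION OF THE cR-LETTERED MEMBER, WITH
THE bg BINDER AND THE RUN GUARD BOTH GONE**: dag-n11-w1 g3's ★★★★★ `thm1Printed_datumOfRecord₁₃SepCoPH_gaussPinH_of_supplierBorel_of_bgFacts_of_powM` (p627901) at `θ` with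
`θ.toStage13Params = θ₁₃(n_c, ε₂₉)` (the member: θ₁₅ᶜᶜᴹᵂ's numerics with `s2.cR := c`, `2 ≤ c ≤ 8`), its `hbgs` DISCHARGED by `…BgRowGaugeRAtCRLetteredMember` §3 (the GaugeR
road — (8), (9), the β-box's (hcomp)∧(hcompRev), `j + 1 ≤ F.m`; NO `PartCompat₁₃`), `hcR` by `two_le_cR_of_ccmwCRH`, the five numeric rows by `numericRows_of_ccmwCRH` (the four
γ-conditions), nesting ∕ `M = L^j` ∕ `0 < M₁ ≤ M` ∕ the live selector ∕ the signs of `κ, E₀, B₀` by `rfl`-numerals.  REMAINING displayed hypotheses: the key `h : θ.Provisos₁₃SepCoPH`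
(at the history-blind door it is dag-n11-w3's door theorem — next theorem), the window∕sign letters, (8) `h15`, (9) `h9`, the sign-free β-box, `2 ≤ c ≤ 8`, `hjm`, K0's per-cube
[15]-solvability `hsolv` along the windowed runs, and [III] §3's supplier `σ` with `SupplierObligations ∧ SupplierBorel` on the windowed runs — NO bg binder, NO run guard, NO
geometric row.  CONDITIONAL; nothing of Bałaban asserted; NOT a discharge of N11 (the supplier is [III] §3, XL; the solvability is K0⁷'s).
[cite: Balaban1988Convergent, Thm 1 p.262, Theorem p.245, §3 p.279, (0.2) p.244, (2.28) p.259, (3.16) p.268, (3.24)–(3.25) p.270; Balaban1989LargeFieldII, Thm 1 p.355; Balaban1989LargeFieldI, (0.3)–(0.4) p.176; Balaban1985Variational, (6)–(7) p.278, Thm 1 (8)–(9) p.279, (144)–(152) pp.300–301; Balaban1987RG1, Thm 1 p.259, (0.20) p.256, (1.12) p.262] -/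
theorem thm1Printed_gaussPinH_ccmwCRH_of_supplierBorel_of_solvable_of_hjm
    (hθ : θ.toStage13Params = theta13LiveOfNumerics F N
      ({ stage12NumericsOfThm1CCMW F.L j γ ε₀ B₃ B₃' a₀ a₁ with s2 := { sect2NumericsOfThm1C F.L with cR := c } } : Stage12Numerics) ε₂₉
      (zeta316OfRecord F N (stage12NumericsOfThm1CCMW F.L j γ ε₀ B₃ B₃' a₀ a₁).ν (stage12NumericsOfThm1CCMW F.L j γ ε₀ B₃ B₃' a₀ a₁).τ9.M
        (stage12NumericsOfThm1CCMW F.L j γ ε₀ B₃ B₃' a₀ a₁).A₁) (RzOfRecord F N) (ZtOfRecord F N))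
    (hjm : j + 1 ≤ F.m) (hc2 : 2 ≤ c) (hc8 : c ≤ 8) (hj : 1 ≤ j) (hε : 0 < ε₀) (hε' : 0 < ε₂₉) (hB : 0 ≤ B₃) (hB' : 0 ≤ B₃') (ha₀ : 0 < a₀) (ha₁ : 0 < a₁)
    (hγ0 : 0 < γ) (hγe : γ ≤ Real.exp (-1))
    (h3γ : 3 * (F.L : ℝ) ^ j ≤ F.L * Real.log (γ ^ 2)⁻¹) (hRγ : ((8 * F.L + 3 : ℕ) : ℝ) ≤ F.L * Real.log (γ ^ 2)⁻¹)
    (hε3γ : 36608 * (γ * Real.log (γ ^ 2)⁻¹) ≤ 16 / 3) (hε2γ : γ * Real.log (γ ^ 2)⁻¹ ≤ 16 * ExpMeanLog.deltaSU (Fin N) / ((8 * F.L : ℕ) : ℝ) ^ 2)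
    (h15 : VariationalThm1RegSepCoP7M F N B₃ a₀ a₁) (hc₁₅ : c₁₅ ≤ F.L ^ j)
    (h9 : Gauge9RegSepTopStepR F N (fun ν K Ω => suppDomOfRecord F ν K Ω) (F.L ^ j) c₁₅ B₃ B₃' a₀ a₁)
    {bl β' : ℝ} (hbox : BetaLowerH bl γ (betaOfRecord₁₃ F N (theta13OfThm1CCMW F N j γ ε₀ ε₂₉ B₃ B₃' a₀ a₁)))
    (hbox' : BetaUpperH β' γ (betaOfRecord₁₃ F N (theta13OfThm1CCMW F N j γ ε₀ ε₂₉ B₃ B₃' a₀ a₁))) (hl : -bl * γ ^ 2 ≤ 3) (hβ' : β' * γ ^ 2 ≤ 3 / 4)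
    (h : θ.Provisos₁₃SepCoPH F N)
    (hsolv : ∀ P : B12.RunParams, Step.InInterval γ P.K (gOfRecord₁₃ F N θ.toStage13Params P) → ∀ i, 1 ≤ i → i ≤ P.K →
      ∀ (s : SeqOfRecord F θ.toStage13Params.ν θ.toStage13Params.τ9.M (gOfRecord₁₃ F N θ.toStage13Params P) P.K i) (V : GaugeField (F.P P.K) i (SU N)),
      chiSeqOfRecord F N θ.toStage13Params.ν θ.toStage13Params.τ9.M (gOfRecord₁₃ F N θ.toStage13Params P) P.K i s V ≠ 0 →
      ∀ a ∈ cubesIn (fun a : ↥(cubeIndices (F.P P.K) (cubeSide (F.P P.K).L θ.toStage13Params.ν.M₂ (RkOfRecord (F.P P.K).L θ.toStage13Params.ν.r (gOfRecord₁₃ F N θ.toStage13Params P i)) i)) =>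
          cubeEnl (F.P P.K) (cubeSide (F.P P.K).L θ.toStage13Params.ν.M₂ (RkOfRecord (F.P P.K).L θ.toStage13Params.ν.r (gOfRecord₁₃ F N θ.toStage13Params P i)) i) a 0) (s.Ω i),
        ∃ U₀, IsMinimizer (avOfRecord F N P.K) {U | PlaqSmall (θ.toStage13Params.ν.εreg * (F.P P.K).eta i ^ 2) U}
          (Bj θ.toStage13Params.ν.M₁ (cubeEnl (F.P P.K) (cubeSide (F.P P.K).L θ.toStage13Params.ν.M₂ (RkOfRecord (F.P P.K).L θ.toStage13Params.ν.r (gOfRecord₁₃ F N θ.toStage13Params P i)) i) a 4) i)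
          (avgFamily (avOfRecord F N P.K) (qsstarGIter0 i V)) U₀)
    (σ : (P : B12.RunParams) → Sect3Supplier (gaussPinH θ) P)
    (hσ : ∀ P : B12.RunParams, Step.InInterval γ P.K (gOfRecord₁₃ F N θ.toStage13Params P) → SupplierObligations (gaussPinH θ) P (σ P))
    (hσB : ∀ P : B12.RunParams, Step.InInterval γ P.K (gOfRecord₁₃ F N θ.toStage13Params P) → SupplierBorel (gaussPinH θ) P (σ P)) :
    B16.Thm1Printed (datumOfRecord₁₃SepCoPH F N (gaussPinH θ) (provisos₁₃SepCoPH_gaussPinH h)).C := by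
  have hγh : γ ≤ 1 / 2 := hγe.trans (Real.exp_neg_one_lt_d9.le.trans (by norm_num))
  -- the member's θ-level letters (dag-n11-w3 g4), read BEFORE destructuring `θ`
  have hrows := fun (P : B12.RunParams) (hw : Step.InInterval γ P.K (gOfRecord₁₃ F N θ.toStage13Params P)) =>
    numericRows_of_ccmwCRH hθ hB hB' ha₀ ha₁ hγ0 hγe h3γ hRγ hε3γ hε2γ P hw
  have hcR := two_le_cR_of_ccmwCRH hθ hc2
  obtain ⟨⟨θ₁, Zr⟩, Zh, Phih⟩ := θ
  obtain rfl : θ₁ = _ := hθ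
  -- (hcomp) ∧ (hcompRev) at the member from the sign-free β-box, then the bg facts WITHOUT the run guard (this seat's GaugeR road at the member)
  have H := hcompBoth_ccmwCR_of_betaBoxSignFree (F := F) (N := N) (j := j) (c := c) (ε₀ := ε₀) (ε₂₉ := ε₂₉) (B₃ := B₃) (B₃' := B₃') (a₀ := a₀) (a₁ := a₁)
    (θ := theta13LiveOfNumerics F N ({ stage12NumericsOfThm1CCMW F.L j γ ε₀ B₃ B₃' a₀ a₁ with s2 := { sect2NumericsOfThm1C F.L with cR := c } } : Stage12Numerics) ε₂₉ (zeta316OfRecord F N (stage12NumericsOfThm1CCMW F.L j γ ε₀ B₃ B₃' a₀ a₁).ν (stage12NumericsOfThm1CCMW F.L j γ ε₀ B₃ B₃' a₀ a₁).τ9.M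
        (stage12NumericsOfThm1CCMW F.L j γ ε₀ B₃ B₃' a₀ a₁).A₁) (RzOfRecord F N) (ZtOfRecord F N))
    rfl (by linarith) hγh hB hB' ha₀.le ha₁.le hbox hbox' hl hβ'
  have hbgs := bgFacts_ccmwCRH_of_thm1GaugeR_of_hcomp_of_hjm
    (θH := (⟨⟨theta13LiveOfNumerics F N ({ stage12NumericsOfThm1CCMW F.L j γ ε₀ B₃ B₃' a₀ a₁ with s2 := { sect2NumericsOfThm1C F.L with cR := c } } : Stage12Numerics) ε₂₉ (zeta316OfRecord F N (stage12NumericsOfThm1CCMW F.L j γ ε₀ B₃ B₃' a₀ a₁).ν (stage12NumericsOfThm1CCMW F.L j γ ε₀ B₃ B₃' a₀ a₁).τ9.M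
        (stage12NumericsOfThm1CCMW F.L j γ ε₀ B₃ B₃' a₀ a₁).A₁) (RzOfRecord F N) (ZtOfRecord F N), Zr⟩, Zh, Phih⟩ : Stage13HParams F N))
    rfl rfl hjm (by linarith) hc8 hγ0 hγh hε hε' hB hB' ha₀ ha₁ h15 hc₁₅ (variationalThm1GaugeRegSepCoP7MR_of_gauge9TopStepR h9) H.1 H.2 (γ' := γ) le_rfl
  have hγ1 : γ < 1 := hγe.trans_lt (Real.exp_lt_one_iff.mpr (by norm_num))
  have hpos := ccmwCR_pos (L := F.L) (j := j) (ε₀ := ε₀) (B₃ := B₃) (B₃' := B₃') (a₀ := a₀) (a₁ := a₁) (by have := F.hL11; omega) hγ0 hγ1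
    (by linarith : (0 : ℝ) < c) hε hB hB' ha₀ ha₁
  have hadm := (admissible_theta13OfNumerics (n := ({ stage12NumericsOfThm1CCMW F.L j γ ε₀ B₃ B₃' a₀ a₁ with s2 := { sect2NumericsOfThm1C F.L with cR := c } } : Stage12Numerics)) F N (zeta316OfRecord F N (stage12NumericsOfThm1CCMW F.L j γ ε₀ B₃ B₃' a₀ a₁).ν (stage12NumericsOfThm1CCMW F.L j γ ε₀ B₃ B₃' a₀ a₁).τ9.M
        (stage12NumericsOfThm1CCMW F.L j γ ε₀ B₃ B₃' a₀ a₁).A₁) (RzOfRecord F N) (ZtOfRecord F N) hpos hε').liveRepin₁₃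
  refine thm1Printed_datumOfRecord₁₃SepCoPH_gaussPinH_of_supplierBorel_of_bgFacts_of_powM _ h rfl hadm
    (by change (0 : ℝ) ≤ 20000; norm_num) (by change (0 : ℝ) ≤ 1; norm_num) (by change (0 : ℝ) ≤ 1; norm_num)
    (show 0 < F.L ^ j from pow_pos (by have := F.hL11; omega) _) le_rfl hcR hγ0 hbgs ?_ (a := j) rfl
    (fun P hw => (hrows P hw).1) (fun P hw => (hrows P hw).2.1) (fun P hw => (hrows P hw).2.2.1) (fun P hw => (hrows P hw).2.2.2.1)
    (fun P hw => (hrows P hw).2.2.2.2) hsolv σ hσ hσB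
  show F.L * 1 ∣ F.L ^ j
  rw [mul_one]
  exact dvd_pow_self _ (by omega)

/-- **★★★★★ THE SAME OVER THE MEMBER's HISTORY-BLIND DOOR, KEY INCLUDED**: the key `h` is dag-n11-w3 g4's door theorem
`provisos₁₃SepCoPH_door_ccmwCR_of_gauge9TopStepR_of_betaBoxSignFree_allTorus` (Part 14 §0c's K0-side inputs VERBATIM + `0 < c ≤ 8`), so at
`θ := Stage13HParams.ofHistoryBlind F N ⟨θ₁₃(n_c, ε₂₉), ZrOfRecord₁₃ …⟩` N11's PRINTED OUTPUT at the Gaussian certificate's K1-keyed datum follows from: the window∕sign letters and the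
four γ-conditions, (8) `h15`, (9) `h9`, the sign-free β-box, `2 ≤ c ≤ 8`, `1 ≤ j`, `j + 1 ≤ F.m`, K0's per-cube [15]-solvability along the windowed runs, and [III] §3's supplier with
`SupplierObligations ∧ SupplierBorel` on the windowed runs — NOTHING ELSE (no bg binder, no run guard, no geometric row, no `hsel`∕numeral side conditions).  CONDITIONAL; nothing of
Bałaban asserted; NOT a discharge. [cite: Balaban1988Convergent, Thm 1 p.262, Theorem p.245, §3 p.279, (2.28) p.259, (3.24)–(3.25) p.270; Balaban1989LargeFieldII, Thm 1 p.355; Balaban1985Variational, Thm 1 (8)–(9) p.279, (144)–(152) pp.300–301, Prop. 8 p.304; Balaban1987RG1, Thm 1 p.259, (0.20) p.256, (1.20)–(1.22) p.264] -/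
theorem thm1Printed_gaussPinH_door_ccmwCR_of_supplierBorel_of_solvable_of_hjm {θ₀ : Stage13Params F N}
    (hθ₀ : θ₀ = theta13LiveOfNumerics F N
      ({ stage12NumericsOfThm1CCMW F.L j γ ε₀ B₃ B₃' a₀ a₁ with s2 := { sect2NumericsOfThm1C F.L with cR := c } } : Stage12Numerics) ε₂₉
      (zeta316OfRecord F N (stage12NumericsOfThm1CCMW F.L j γ ε₀ B₃ B₃' a₀ a₁).ν (stage12NumericsOfThm1CCMW F.L j γ ε₀ B₃ B₃' a₀ a₁).τ9.M
        (stage12NumericsOfThm1CCMW F.L j γ ε₀ B₃ B₃' a₀ a₁).A₁) (RzOfRecord F N) (ZtOfRecord F N))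
    (hjm : j + 1 ≤ F.m) (hc2 : 2 ≤ c) (hc8 : c ≤ 8) (hj : 1 ≤ j) (hε : 0 < ε₀) (hε' : 0 < ε₂₉) (hB : 0 ≤ B₃) (hB' : 0 ≤ B₃') (ha₀ : 0 < a₀) (ha₁ : 0 < a₁)
    (hγ0 : 0 < γ) (hγe : γ ≤ Real.exp (-1))
    (h3γ : 3 * (F.L : ℝ) ^ j ≤ F.L * Real.log (γ ^ 2)⁻¹) (hRγ : ((8 * F.L + 3 : ℕ) : ℝ) ≤ F.L * Real.log (γ ^ 2)⁻¹)
    (hε3γ : 36608 * (γ * Real.log (γ ^ 2)⁻¹) ≤ 16 / 3) (hε2γ : γ * Real.log (γ ^ 2)⁻¹ ≤ 16 * ExpMeanLog.deltaSU (Fin N) / ((8 * F.L : ℕ) : ℝ) ^ 2)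
    (h15 : VariationalThm1RegSepCoP7M F N B₃ a₀ a₁) (hc₁₅ : c₁₅ ≤ F.L ^ j)
    (h9 : Gauge9RegSepTopStepR F N (fun ν K Ω => suppDomOfRecord F ν K Ω) (F.L ^ j) c₁₅ B₃ B₃' a₀ a₁)
    {bl β' : ℝ} (hbox : BetaLowerH bl γ (betaOfRecord₁₃ F N (theta13OfThm1CCMW F N j γ ε₀ ε₂₉ B₃ B₃' a₀ a₁)))
    (hbox' : BetaUpperH β' γ (betaOfRecord₁₃ F N (theta13OfThm1CCMW F N j γ ε₀ ε₂₉ B₃ B₃' a₀ a₁))) (hl : -bl * γ ^ 2 ≤ 3) (hβ' : β' * γ ^ 2 ≤ 3 / 4)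
    (hsolv : ∀ P : B12.RunParams, Step.InInterval γ P.K (gOfRecord₁₃ F N θ₀ P) → ∀ i, 1 ≤ i → i ≤ P.K →
      ∀ (s : SeqOfRecord F θ₀.ν θ₀.τ9.M (gOfRecord₁₃ F N θ₀ P) P.K i) (V : GaugeField (F.P P.K) i (SU N)),
      chiSeqOfRecord F N θ₀.ν θ₀.τ9.M (gOfRecord₁₃ F N θ₀ P) P.K i s V ≠ 0 →
      ∀ a ∈ cubesIn (fun a : ↥(cubeIndices (F.P P.K) (cubeSide (F.P P.K).L θ₀.ν.M₂ (RkOfRecord (F.P P.K).L θ₀.ν.r (gOfRecord₁₃ F N θ₀ P i)) i)) =>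
          cubeEnl (F.P P.K) (cubeSide (F.P P.K).L θ₀.ν.M₂ (RkOfRecord (F.P P.K).L θ₀.ν.r (gOfRecord₁₃ F N θ₀ P i)) i) a 0) (s.Ω i),
        ∃ U₀, IsMinimizer (avOfRecord F N P.K) {U | PlaqSmall (θ₀.ν.εreg * (F.P P.K).eta i ^ 2) U}
          (Bj θ₀.ν.M₁ (cubeEnl (F.P P.K) (cubeSide (F.P P.K).L θ₀.ν.M₂ (RkOfRecord (F.P P.K).L θ₀.ν.r (gOfRecord₁₃ F N θ₀ P i)) i) a 4) i)
          (avgFamily (avOfRecord F N P.K) (qsstarGIter0 i V)) U₀)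
    (σ : (P : B12.RunParams) → Sect3Supplier (gaussPinH (Stage13HParams.ofHistoryBlind F N ⟨θ₀, ZrOfRecord₁₃ F N θ₀⟩)) P)
    (hσ : ∀ P : B12.RunParams, Step.InInterval γ P.K (gOfRecord₁₃ F N θ₀ P) → SupplierObligations (gaussPinH (Stage13HParams.ofHistoryBlind F N ⟨θ₀, ZrOfRecord₁₃ F N θ₀⟩)) P (σ P))
    (hσB : ∀ P : B12.RunParams, Step.InInterval γ P.K (gOfRecord₁₃ F N θ₀ P) → SupplierBorel (gaussPinH (Stage13HParams.ofHistoryBlind F N ⟨θ₀, ZrOfRecord₁₃ F N θ₀⟩)) P (σ P)) :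
    B16.Thm1Printed (datumOfRecord₁₃SepCoPH F N (gaussPinH (Stage13HParams.ofHistoryBlind F N ⟨θ₀, ZrOfRecord₁₃ F N θ₀⟩))
      (provisos₁₃SepCoPH_gaussPinH (provisos₁₃SepCoPH_door_ccmwCR_of_gauge9TopStepR_of_betaBoxSignFree_allTorus hθ₀ (by linarith) hc8 hγ0
        (hγe.trans (Real.exp_neg_one_lt_d9.le.trans (by norm_num))) hε hε' hB hB' ha₀ ha₁ h15 hc₁₅ h9 hbox hbox' hl hβ'))).C :=
  thm1Printed_gaussPinH_ccmwCRH_of_supplierBorel_of_solvable_of_hjm (θ := Stage13HParams.ofHistoryBlind F N ⟨θ₀, ZrOfRecord₁₃ F N θ₀⟩) (by subst hθ₀; rfl)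
    hjm hc2 hc8 hj hε hε' hB hB' ha₀ ha₁ hγ0 hγe h3γ hRγ hε3γ hε2γ h15 hc₁₅ h9 hbox hbox' hl hβ'
    (provisos₁₃SepCoPH_door_ccmwCR_of_gauge9TopStepR_of_betaBoxSignFree_allTorus hθ₀ (by linarith) hc8 hγ0
      (hγe.trans (Real.exp_neg_one_lt_d9.le.trans (by norm_num))) hε hε' hB hB' ha₀ ha₁ h15 hc₁₅ h9 hbox hbox' hl hβ') hsolv σ hσ hσB

end Summit.QuantumFields.YangMills.Theorems.BalabanUVNodesN11Thm1PrintedAtCRLetteredMemberOfBgFacts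

end
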